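import Literature.Analysis.FunctionSpaces.PolchinskiReparam
import Literature.Analysis.FunctionSpaces.PolchinskiGenerator
import Literature.Analysis.FunctionSpaces.PolchinskiSmoothing
import HarnessLib

/-!
# The generator identity at a general initial scale: `∂_t P_{s,t}F = L_t P_{s,t}F` (`0 ≤ s < t`)
# (Bauerschmidt–Bodineau–Dagallier, Proposition 8, via the restarted decomposition)

Topic `Literature/Analysis/FunctionSpaces`; twelfth "proof architecture" file behind the named fact
`Polchinski.BauerschmidtBodineau_multiscaleBakryEmery` ([BBD] Theorem 3, `MultiscaleBakryEmery.lean`).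
`PolchinskiGenerator.lean` proves [BBD] Prop 8's generator identity `∂_t P_{s,t}F = L_tP_{s,t}F` for
`s = 0`.  The general case `0 ≤ s < t` (needed for `ψ(s) = e^{−2λ_t+2λ_s}P_{s,t}[(∇√P_{0,s}F)²_{Ċ_s}]` in the
proof of Theorem 3, p0016 L150–153) is obtained here by RESTARTING the decomposition at scale `s`
(`CovDecomposition.shift`, [BBD] (eq: semigroup structure)): `P'_{0,τ} = P_{s,s+τ}`, `V'_τ = V_{s+τ}`,
`Ċ'_τ = Ċ_{s+τ}` (`PolchinskiReparam.lean`), the initial potential `V_s` having the density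
`e^{−V_s} = Z_s = E_{C_s}[e^{−V₀}(·+w)] ∈ C_b²` (`PolchinskiEquation.lean`, `PolchinskiSmoothing.lean`).

## Main result (sorry-free; no new definitions, no new named facts)

* **`hasDerivAt_semigroup_eq_generator`** — for `0 ≤ s < t`, `F ∈ C_b²`: there are a gradient field `gP`
  of `P_{s,t}F` and its Hessian `HP` at `φ` with
  `∂_t P_{s,t}F(φ) = ½ Σ Ċ_t^{ij} HP(e_i,e_j) − Σ Ċ_t^{ij} ∂_iV_t(φ) gP(φ)(e_j)`, `∇V_t = −∇Z_t/Z_t` as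
  certified by `hasFDerivAt_renormPotential`.

Nothing here concerns Yang–Mills.

## References

* [BauerschmidtBodineauDagallier2023] R. Bauerschmidt, T. Bodineau, B. Dagallier, Probab. Surveys 21
  (2024) 200–290, arXiv:2307.07619 — Prop 8 p0014 L91–104, (eq: semigroup structure) p0014 L16–22,
  Thm 3 proof p0016 L150–153. READ (held).
-/

noncomputable section

-- nested operator-norm instances `E →L[ℝ] E →L[ℝ] ℝ`
set_option maxSynthPendingDepth 2

open MeasureTheory ProbabilityTheory Filter Topology Set
open scoped RealInnerProductSpace Matrix MatrixOrder

namespace Literature.Analysis.FunctionSpaces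

namespace Polchinski

variable {N : ℕ}

section Helpers

/-- Uniform continuity from a bounded Fréchet derivative. [folklore] -/
private theorem uc_of_fderiv_bound {Y : Type*} [NormedAddCommGroup Y] [NormedSpace ℝ Y]
    {H : EuclideanSpace ℝ (Fin N) → Y} {DH : EuclideanSpace ℝ (Fin N) → EuclideanSpace ℝ (Fin N) →L[ℝ] Y}
    (h1 : ∀ x, HasFDerivAt H (DH x) x) {K : ℝ} (hK : ∀ x, ‖DH x‖ ≤ K) : UniformContinuous H := by
  have hK0 : 0 ≤ K := le_trans (norm_nonneg _) (hK 0)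
  have hlip : ∀ a b : EuclideanSpace ℝ (Fin N), ‖H a - H b‖ ≤ K * ‖a - b‖ := fun a b =>
    Convex.norm_image_sub_le_of_norm_hasFDerivWithin_le (𝕜 := ℝ) (s := univ)
      (fun x _ => (h1 x).hasFDerivWithinAt) (fun x _ => hK x) convex_univ (mem_univ b) (mem_univ a)
  rw [Metric.uniformContinuous_iff]
  intro ε hε
  refine ⟨ε / (K + 1), by positivity, fun {a b} hab => ?_⟩
  rw [dist_eq_norm] at hab ⊢
  calc ‖H a - H b‖ ≤ K * ‖a - b‖ := hlip a b
    _ ≤ K * (ε / (K + 1)) := mul_le_mul_of_nonneg_left hab.le hK0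
    _ < ε := by
      rw [mul_div_assoc']
      rw [div_lt_iff₀ (by positivity)]
      nlinarith

/-- The product of a bounded uniformly continuous scalar function and a bounded uniformly continuous
vector-valued function is uniformly continuous. [folklore] -/
private theorem uc_smul {Y : Type*} [NormedAddCommGroup Y] [NormedSpace ℝ Y]
    {a : EuclideanSpace ℝ (Fin N) → ℝ} {b : EuclideanSpace ℝ (Fin N) → Y}
    (ha : UniformContinuous a) (hb : UniformContinuous b) {A : ℝ} (hA : ∀ x, |a x| ≤ A)
    {B : ℝ} (hB : ∀ x, ‖b x‖ ≤ B) : UniformContinuous fun x => a x • b x := by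
  have hA0 : 0 ≤ A := le_trans (abs_nonneg _) (hA 0)
  have hB0 : 0 ≤ B := le_trans (norm_nonneg _) (hB 0)
  rw [Metric.uniformContinuous_iff]
  intro ε hε
  obtain ⟨δa, hδa, ha'⟩ := Metric.uniformContinuous_iff.mp ha (ε / (2 * (B + 1))) (by positivity)
  obtain ⟨δb, hδb, hb'⟩ := Metric.uniformContinuous_iff.mp hb (ε / (2 * (A + 1))) (by positivity)
  refine ⟨min δa δb, lt_min hδa hδb, fun {x y} hxy => ?_⟩
  have hxa : dist x y < δa := lt_of_lt_of_le hxy (min_le_left _ _)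
  have hxb : dist x y < δb := lt_of_lt_of_le hxy (min_le_right _ _)
  have h1 := ha' hxa
  have h2 := hb' hxb
  rw [dist_eq_norm] at h1 h2 ⊢
  have hsplit : a x • b x - a y • b y = a x • (b x - b y) + (a x - a y) • b y := by
    rw [smul_sub, sub_smul]; abel
  rw [hsplit]
  calc ‖a x • (b x - b y) + (a x - a y) • b y‖
      ≤ ‖a x • (b x - b y)‖ + ‖(a x - a y) • b y‖ := norm_add_le _ _
    _ = |a x| * ‖b x - b y‖ + |a x - a y| * ‖b y‖ := by
        rw [norm_smul, norm_smul, Real.norm_eq_abs, Real.norm_eq_abs]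
    _ ≤ A * (ε / (2 * (A + 1))) + (ε / (2 * (B + 1))) * B := by
        have h1' : |a x - a y| ≤ ε / (2 * (B + 1)) := by rw [← Real.norm_eq_abs]; exact h1.le
        exact add_le_add (mul_le_mul (hA x) h2.le (norm_nonneg _) hA0)
          (mul_le_mul h1' (hB y) (norm_nonneg _) (by positivity))
    _ < ε := by
        have h3 : A * (ε / (2 * (A + 1))) < ε / 2 := by
          rw [mul_div_assoc', div_lt_div_iff₀ (by positivity) (by positivity)]; nlinarith
        have h4 : (ε / (2 * (B + 1))) * B < ε / 2 := by
          rw [div_mul_eq_mul_div, div_lt_div_iff₀ (by positivity) (by positivity)]; nlinarith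
        linarith

/-- `x ↦ c(x) ⊗ d(x)` (`smulRight`) is uniformly continuous for bounded uniformly continuous covector
fields `c`, `d`. [folklore] -/
private theorem uc_smulRight
    {c d : EuclideanSpace ℝ (Fin N) → EuclideanSpace ℝ (Fin N) →L[ℝ] ℝ}
    (hc : UniformContinuous c) (hd : UniformContinuous d) {Cc : ℝ} (hCc : ∀ x, ‖c x‖ ≤ Cc)
    {Cd : ℝ} (hCd : ∀ x, ‖d x‖ ≤ Cd) :
    UniformContinuous fun x => (c x).smulRight (d x) := by
  have hC0 : 0 ≤ Cc := le_trans (norm_nonneg _) (hCc 0)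
  have hD0 : 0 ≤ Cd := le_trans (norm_nonneg _) (hCd 0)
  rw [Metric.uniformContinuous_iff]
  intro ε hε
  obtain ⟨δc, hδc, hc'⟩ := Metric.uniformContinuous_iff.mp hc (ε / (2 * (Cd + 1))) (by positivity)
  obtain ⟨δd, hδd, hd'⟩ := Metric.uniformContinuous_iff.mp hd (ε / (2 * (Cc + 1))) (by positivity)
  refine ⟨min δc δd, lt_min hδc hδd, fun {x y} hxy => ?_⟩
  have h1 := hc' (lt_of_lt_of_le hxy (min_le_left _ _))
  have h2 := hd' (lt_of_lt_of_le hxy (min_le_right _ _))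
  rw [dist_eq_norm] at h1 h2 ⊢
  have hsplit : (c x).smulRight (d x) - (c y).smulRight (d y) =
      (c x - c y).smulRight (d x) + (c y).smulRight (d x - d y) := by
    refine ContinuousLinearMap.ext fun v => ContinuousLinearMap.ext fun w => ?_
    simp only [_root_.sub_apply, _root_.add_apply, ContinuousLinearMap.smulRight_apply,
      _root_.smul_apply, smul_eq_mul]
    ring
  rw [hsplit]
  calc ‖(c x - c y).smulRight (d x) + (c y).smulRight (d x - d y)‖
      ≤ ‖(c x - c y).smulRight (d x)‖ + ‖(c y).smulRight (d x - d y)‖ := norm_add_le _ _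
    _ = ‖c x - c y‖ * ‖d x‖ + ‖c y‖ * ‖d x - d y‖ := by
        rw [ContinuousLinearMap.norm_smulRight_apply, ContinuousLinearMap.norm_smulRight_apply]
    _ ≤ (ε / (2 * (Cd + 1))) * Cd + Cc * (ε / (2 * (Cc + 1))) :=
        add_le_add (mul_le_mul h1.le (hCd x) (norm_nonneg _) (by positivity))
          (mul_le_mul (hCc y) h2.le (norm_nonneg _) hC0)
    _ < ε := by
        have h3 : (ε / (2 * (Cd + 1))) * Cd < ε / 2 := by
          rw [div_mul_eq_mul_div, div_lt_div_iff₀ (by positivity) (by positivity)]; nlinarith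
        have h4 : Cc * (ε / (2 * (Cc + 1))) < ε / 2 := by
          rw [mul_div_assoc', div_lt_div_iff₀ (by positivity) (by positivity)]; nlinarith
        linarith

end Helpers

section General

variable (D : CovDecomposition N) {V₀ : EuclideanSpace ℝ (Fin N) → ℝ}
  {D1 : EuclideanSpace ℝ (Fin N) → EuclideanSpace ℝ (Fin N) →L[ℝ] ℝ}
  {D2 : EuclideanSpace ℝ (Fin N) → EuclideanSpace ℝ (Fin N) →L[ℝ] EuclideanSpace ℝ (Fin N) →L[ℝ] ℝ}
  {F : EuclideanSpace ℝ (Fin N) → ℝ}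
  {DF : EuclideanSpace ℝ (Fin N) → EuclideanSpace ℝ (Fin N) →L[ℝ] ℝ}
  {D2F : EuclideanSpace ℝ (Fin N) → EuclideanSpace ℝ (Fin N) →L[ℝ] EuclideanSpace ℝ (Fin N) →L[ℝ] ℝ}

/-- **[BBD] Proposition 8 — `∂_t P_{s,t}F = L_t P_{s,t}F` at a general initial scale `0 ≤ s < t`.**
Let `C_t` be a covariance decomposition (possibly degenerate `Ċ_t`), `V₀` bounded below with `e^{−V₀}` twice
Fréchet differentiable (`∇e^{−V₀}` bounded, `D²e^{−V₀}` bounded uniformly continuous), and `F` bounded,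
twice Fréchet differentiable with `∇F` bounded and `D²F` bounded uniformly continuous.  Then there are a
gradient field `gP` of `P_{s,t}F` (`∇(P_{s,t}F)(ψ) = gP ψ` for all `ψ`) and its derivative `HP` at `φ` with
`∂_t P_{s,t}F(φ) = ½ Σ_{ij} Ċ_t^{ij} HP(e_i,e_j) − Σ_{ij} Ċ_t^{ij} ∂_iV_t(φ) gP(φ)(e_j) = (L_tP_{s,t}F)(φ)`
((e:polchinski-generator), first identity), where `∇V_t(φ) = −∇Z_t(φ)/Z_t(φ)` is the derivative certified
by `hasFDerivAt_renormPotential`.  Proof: `hasDerivAt_semigroup_zero_eq_generator` for the decomposition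
restarted at `s` with initial potential `V_s` (`e^{−V_s} = Z_s ∈ C_b²`), transported back by
`semigroup_shift_zero` and the Gaussian semigroup identities `Z_t = E_{C_t−C_s}[Z_s(·+w)]`,
`∇Z_t = E_{C_t−C_s}[∇Z_s(·+w)]`. [cite: BauerschmidtBodineauDagallier2023, Proposition 8] -/
theorem hasDerivAt_semigroup_eq_generator
    (hG1 : ∀ x, HasFDerivAt (fun x => Real.exp (-V₀ x)) (D1 x) x)
    (hG2 : ∀ x, HasFDerivAt D1 (D2 x) x) {b : ℝ} (hb : ∀ φ, b ≤ V₀ φ)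
    {K1 : ℝ} (hK1 : ∀ x, ‖D1 x‖ ≤ K1) {M : ℝ} (hM : ∀ x, ‖D2 x‖ ≤ M) (hUC : UniformContinuous D2)
    (hF1 : ∀ x, HasFDerivAt F (DF x) x) (hF2 : ∀ x, HasFDerivAt DF (D2F x) x)
    {KF : ℝ} (hFb : ∀ x, |F x| ≤ KF) {LF : ℝ} (hDF : ∀ x, ‖DF x‖ ≤ LF)
    {MF : ℝ} (hD2F : ∀ x, ‖D2F x‖ ≤ MF) (hUCF : UniformContinuous D2F)
    {s t : ℝ} (hs : 0 ≤ s) (hst : s < t) (φ : EuclideanSpace ℝ (Fin N)) :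
    ∃ (gP : EuclideanSpace ℝ (Fin N) → EuclideanSpace ℝ (Fin N) →L[ℝ] ℝ)
      (HP : EuclideanSpace ℝ (Fin N) →L[ℝ] EuclideanSpace ℝ (Fin N) →L[ℝ] ℝ),
      (∀ ψ, HasFDerivAt (fun ψ => semigroup D V₀ s t F ψ) (gP ψ) ψ) ∧
      HasFDerivAt gP HP φ ∧
      HasDerivAt (fun t' => semigroup D V₀ s t' F φ)
        ((1 / 2) * ∑ i, ∑ j, D.Cdot t i j *
            HP (EuclideanSpace.single i 1) (EuclideanSpace.single j 1) -
          ∑ i, ∑ j, D.Cdot t i j *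
            (-((∫ ζ, Real.exp (-V₀ (φ + ζ)) ∂(multivariateGaussian 0 (D.C t)))⁻¹ •
                ∫ ζ, D1 (φ + ζ) ∂(multivariateGaussian 0 (D.C t)))) (EuclideanSpace.single i 1) *
              gP φ (EuclideanSpace.single j 1)) t := by
  have hD2c : Continuous D2 := hUC.continuous
  have hc : Continuous fun x => Real.exp (-V₀ x) :=
    continuous_iff_continuousAt.2 fun x => (hG1 x).continuousAt
  have hV : Measurable V₀ := by
    have he : V₀ = fun x => -Real.log (Real.exp (-V₀ x)) := by
      funext x; rw [Real.log_exp, neg_neg]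
    rw [he]
    exact (Real.measurable_log.comp hc.measurable).neg
  set τ : ℝ := t - s with hτdef
  have hτ : 0 < τ := sub_pos.2 hst
  have hτt : s + τ = t := by rw [hτdef]; ring
  -- the restarted decomposition and the initial potential `V_s` with density `Z_s`
  set D' := D.shift s hs with hD'
  have hZ1 : ∀ y, HasFDerivAt
      (fun y => ∫ ζ, Real.exp (-V₀ (y + ζ)) ∂(multivariateGaussian 0 (D.C s)))
      (∫ ζ, D1 (y + ζ) ∂(multivariateGaussian 0 (D.C s))) y :=
    fun y => hasFDerivAt_integral_exp_neg D hG1 hG2 hb hK1 s y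
  have hZ2 : ∀ y, HasFDerivAt (fun y => ∫ ζ, D1 (y + ζ) ∂(multivariateGaussian 0 (D.C s)))
      (∫ ζ, D2 (y + ζ) ∂(multivariateGaussian 0 (D.C s))) y :=
    fun y => hasFDerivAt_integral_fderiv_exp_neg D hG2 hK1 hM hD2c s y
  have hZpos : ∀ y, 0 < ∫ ζ, Real.exp (-V₀ (y + ζ)) ∂(multivariateGaussian 0 (D.C s)) :=
    fun y => integral_exp_neg_pos hV hb _ y
  have hZb : ∀ y, |∫ ζ, Real.exp (-V₀ (y + ζ)) ∂(multivariateGaussian 0 (D.C s))| ≤ Real.exp (-b) :=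
    fun y => by rw [abs_of_pos (hZpos y)]; exact integral_exp_neg_le hV hb _ y
  have hDZb : ∀ y, ‖∫ ζ, D1 (y + ζ) ∂(multivariateGaussian 0 (D.C s))‖ ≤ K1 :=
    fun y => norm_integral_shift_le hK1 _ y
  have hHZb : ∀ y, ‖∫ ζ, D2 (y + ζ) ∂(multivariateGaussian 0 (D.C s))‖ ≤ M :=
    fun y => norm_integral_shift_le hM _ y
  have hHZuc : UniformContinuous fun y => ∫ ζ, D2 (y + ζ) ∂(multivariateGaussian 0 (D.C s)) :=
    uniformContinuous_integral_shift hD2c hM hUC _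
  have hexp : (fun x => Real.exp (-renormPotential D V₀ s x)) =
      fun x => ∫ ζ, Real.exp (-V₀ (x + ζ)) ∂(multivariateGaussian 0 (D.C s)) :=
    funext fun x => exp_neg_renormPotential D hV hb s x
  have hG1' : ∀ x, HasFDerivAt (fun x => Real.exp (-renormPotential D V₀ s x))
      (∫ ζ, D1 (x + ζ) ∂(multivariateGaussian 0 (D.C s))) x := by
    rw [hexp]; exact hZ1
  have hb' : ∀ φ, b ≤ renormPotential D V₀ s φ := fun φ => le_renormPotential D hV hb s φ
  -- the product `e^{−V_s} F = Z_s F ∈ C_b²`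
  have hKfun : (fun x => Real.exp (-renormPotential D V₀ s x) * F x) =
      fun x => (∫ ζ, Real.exp (-V₀ (x + ζ)) ∂(multivariateGaussian 0 (D.C s))) * F x := by
    funext x; rw [exp_neg_renormPotential D hV hb s x]
  have hF1' : ∀ x, HasFDerivAt (fun x => Real.exp (-renormPotential D V₀ s x) * F x)
      ((∫ ζ, Real.exp (-V₀ (x + ζ)) ∂(multivariateGaussian 0 (D.C s))) • DF x +
        F x • ∫ ζ, D1 (x + ζ) ∂(multivariateGaussian 0 (D.C s))) x := by
    rw [hKfun]; exact fun x => (hZ1 x).mul (hF1 x)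
  have hF2' : ∀ x, HasFDerivAt
      (fun x => (∫ ζ, Real.exp (-V₀ (x + ζ)) ∂(multivariateGaussian 0 (D.C s))) • DF x +
        F x • ∫ ζ, D1 (x + ζ) ∂(multivariateGaussian 0 (D.C s)))
      ((∫ ζ, Real.exp (-V₀ (x + ζ)) ∂(multivariateGaussian 0 (D.C s))) • D2F x +
          (∫ ζ, D1 (x + ζ) ∂(multivariateGaussian 0 (D.C s))).smulRight (DF x) +
        (F x • (∫ ζ, D2 (x + ζ) ∂(multivariateGaussian 0 (D.C s))) +
          (DF x).smulRight (∫ ζ, D1 (x + ζ) ∂(multivariateGaussian 0 (D.C s))))) x :=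
    fun x => hasFDerivAt_fderiv_mul hZ1 hZ2 hF1 hF2 x
  have hKF0 : 0 ≤ KF := le_trans (abs_nonneg _) (hFb 0)
  have hL1 : ∀ x, ‖(∫ ζ, Real.exp (-V₀ (x + ζ)) ∂(multivariateGaussian 0 (D.C s))) • DF x +
      F x • ∫ ζ, D1 (x + ζ) ∂(multivariateGaussian 0 (D.C s))‖ ≤ Real.exp (-b) * LF + KF * K1 := by
    intro x
    refine norm_add_le_of_le ?_ ?_
    · rw [norm_smul, Real.norm_eq_abs]
      exact mul_le_mul (hZb x) (hDF x) (norm_nonneg _) (Real.exp_pos _).le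
    · rw [norm_smul, Real.norm_eq_abs]
      exact mul_le_mul (hFb x) (hDZb x) (norm_nonneg _) hKF0
  have hMK := fun x => norm_fderiv₂_mul_le_of_bounds hZb hFb hDZb hDF hHZb hD2F x
  have hZuc := uc_of_fderiv_bound hZ1 hDZb
  have hDZuc := uc_of_fderiv_bound hZ2 hHZb
  have hFuc := uc_of_fderiv_bound hF1 hDF
  have hDFuc := uc_of_fderiv_bound hF2 hD2F
  have hUCK : UniformContinuous fun x =>
      (∫ ζ, Real.exp (-V₀ (x + ζ)) ∂(multivariateGaussian 0 (D.C s))) • D2F x +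
          (∫ ζ, D1 (x + ζ) ∂(multivariateGaussian 0 (D.C s))).smulRight (DF x) +
        (F x • (∫ ζ, D2 (x + ζ) ∂(multivariateGaussian 0 (D.C s))) +
          (DF x).smulRight (∫ ζ, D1 (x + ζ) ∂(multivariateGaussian 0 (D.C s)))) :=
    ((uc_smul hZuc hUCF hZb hD2F).add (uc_smulRight hDZuc hDFuc hDZb hDF)).add
      ((uc_smul hFuc hHZuc hFb hHZb).add (uc_smulRight hDFuc hDZuc hDF hDZb))
  -- [BBD] Prop 8 at `s = 0` for the restarted decomposition
  obtain ⟨gP, HP, hT1, hT2, hT3⟩ := hasDerivAt_semigroup_zero_eq_generator D' hG1' hZ2 hb' hDZb hHZb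
    hHZuc hF1' hF2' hFb hL1 hMK hUCK hτ φ
  -- transport back to `D`
  have hsg : ∀ σ : ℝ, 0 ≤ σ → ∀ ψ : EuclideanSpace ℝ (Fin N),
      semigroup D' (renormPotential D V₀ s) 0 σ F ψ = semigroup D V₀ s (s + σ) F ψ :=
    fun σ hσ ψ => semigroup_shift_zero D hV hb hs hσ F ψ
  -- the Gaussian semigroup identities `Z_t = E_{C_t−C_s}[Z_s(·+w)]`, `∇Z_t e_i = E_{C_t−C_s}[∇Z_s(·+w) e_i]`
  have hZ' : (∫ ζ, Real.exp (-renormPotential D V₀ s (φ + ζ)) ∂(multivariateGaussian 0 (D'.C τ))) =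
      ∫ ζ, Real.exp (-V₀ (φ + ζ)) ∂(multivariateGaussian 0 (D.C t)) := by
    rw [hD', CovDecomposition.shift_C, hτt, ← exp_neg_renormPotential_eq_integral_sub D hV hb hs hst.le φ,
      exp_neg_renormPotential D hV hb t φ]
  have hgZ' : ∀ i : Fin N, (∫ ζ, (∫ ζ', D1 (φ + ζ + ζ') ∂(multivariateGaussian 0 (D.C s)))
      ∂(multivariateGaussian 0 (D'.C τ))) (EuclideanSpace.single i 1) =
      (∫ ζ, D1 (φ + ζ) ∂(multivariateGaussian 0 (D.C t))) (EuclideanSpace.single i 1) := by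
    intro i
    have hD1c : Continuous D1 := continuous_iff_continuousAt.2 fun x => (hG2 x).continuousAt
    have hev : Continuous fun L : EuclideanSpace ℝ (Fin N) →L[ℝ] ℝ => L (EuclideanSpace.single i 1) :=
      (ContinuousLinearMap.apply ℝ ℝ (EuclideanSpace.single i (1:ℝ))).continuous
    have hDZc : Continuous fun y => ∫ ζ', D1 (y + ζ') ∂(multivariateGaussian 0 (D.C s)) :=
      continuous_iff_continuousAt.2 fun y => (hZ2 y).continuousAt
    -- integrability of the CLM-valued integrands
    have hI1 : Integrable (fun ζ => ∫ ζ', D1 (φ + ζ + ζ') ∂(multivariateGaussian 0 (D.C s)))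
        (multivariateGaussian 0 (D'.C τ)) :=
      Integrable.of_bound (hDZc.comp (continuous_const.add continuous_id)).aestronglyMeasurable K1
        (Eventually.of_forall fun ζ => hDZb (φ + ζ))
    have hI2 : Integrable (fun ζ => D1 (φ + ζ)) (multivariateGaussian 0 (D.C t)) :=
      Integrable.of_bound (hD1c.comp (continuous_const.add continuous_id)).aestronglyMeasurable K1
        (Eventually.of_forall fun ζ => hK1 (φ + ζ))
    have hI3 : ∀ y, Integrable (fun ζ' => D1 (y + ζ')) (multivariateGaussian 0 (D.C s)) := fun y =>
      Integrable.of_bound (hD1c.comp (continuous_const.add continuous_id)).aestronglyMeasurable K1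
        (Eventually.of_forall fun ζ => hK1 (y + ζ))
    rw [ContinuousLinearMap.integral_apply hI1, ContinuousLinearMap.integral_apply hI2]
    simp_rw [ContinuousLinearMap.integral_apply (hI3 _)]
    -- scalar Gaussian semigroup identity for `x ↦ D1 x e_i`
    have hmeas : Measurable fun x => D1 x (EuclideanSpace.single i 1) := (hev.comp hD1c).measurable
    have hbd : ∀ x, |D1 x (EuclideanSpace.single i 1)| ≤ K1 := fun x => by
      rw [← Real.norm_eq_abs]
      calc ‖D1 x (EuclideanSpace.single i 1)‖ ≤ ‖D1 x‖ * ‖EuclideanSpace.single i (1:ℝ)‖ :=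
            ContinuousLinearMap.le_opNorm _ _
        _ = ‖D1 x‖ := by simp
        _ ≤ K1 := hK1 x
    have h := integral_gaussian_add_shift (D.posSemidef_C_sub hs hst.le) (D.posSemidef_C hs) hmeas hbd φ
    rw [sub_add_cancel] at h
    rw [hD', CovDecomposition.shift_C, hτt, h]
  refine ⟨gP, HP, fun ψ => ?_, hT2, ?_⟩
  · -- spatial derivative: `P'_{0,τ} = P_{s,t}`
    have hfun : (fun ψ => semigroup D V₀ s t F ψ) =
        fun ψ => semigroup D' (renormPotential D V₀ s) 0 τ F ψ := by
      funext ψ; rw [hsg τ hτ.le ψ, hτt]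
    rw [hfun]; exact hT1 ψ
  · -- time derivative: reparametrise `t' = s + σ` and identify the coefficients
    have hT3' : HasDerivAt (fun σ => semigroup D V₀ s (s + σ) F φ)
        ((1 / 2) * ∑ i, ∑ j, D'.Cdot τ i j *
            HP (EuclideanSpace.single i 1) (EuclideanSpace.single j 1) -
          ∑ i, ∑ j, D'.Cdot τ i j *
            (-((∫ ζ, Real.exp (-renormPotential D V₀ s (φ + ζ)) ∂(multivariateGaussian 0 (D'.C τ)))⁻¹ •
                ∫ ζ, (∫ ζ', D1 (φ + ζ + ζ') ∂(multivariateGaussian 0 (D.C s)))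
                  ∂(multivariateGaussian 0 (D'.C τ)))) (EuclideanSpace.single i 1) *
              gP φ (EuclideanSpace.single j 1)) τ := by
      refine hT3.congr_of_eventuallyEq ?_
      filter_upwards [isOpen_Ioi.mem_nhds hτ] with σ hσ
      exact (hsg σ (le_of_lt hσ) φ).symm
    have hcomp := hT3'.comp t ((hasDerivAt_id' t).sub_const s)
    have hfun2 : ((fun σ => semigroup D V₀ s (s + σ) F φ) ∘ fun t' => t' - s) =
        fun t' => semigroup D V₀ s t' F φ := by
      funext t'; simp [add_sub_cancel]
    rw [hfun2, mul_one] at hcomp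
    refine hcomp.congr_deriv ?_
    have hCdot : ∀ i j, D'.Cdot τ i j = D.Cdot t i j := fun i j => by
      rw [hD', CovDecomposition.shift_Cdot, hτt]
    have hentry : ∀ i : Fin N,
        (-((∫ ζ, Real.exp (-renormPotential D V₀ s (φ + ζ)) ∂(multivariateGaussian 0 (D'.C τ)))⁻¹ •
            ∫ ζ, (∫ ζ', D1 (φ + ζ + ζ') ∂(multivariateGaussian 0 (D.C s)))
              ∂(multivariateGaussian 0 (D'.C τ)))) (EuclideanSpace.single i 1) =
        (-((∫ ζ, Real.exp (-V₀ (φ + ζ)) ∂(multivariateGaussian 0 (D.C t)))⁻¹ •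
            ∫ ζ, D1 (φ + ζ) ∂(multivariateGaussian 0 (D.C t)))) (EuclideanSpace.single i 1) := by
      intro i
      simp only [_root_.neg_apply, _root_.smul_apply, smul_eq_mul]
      rw [hZ', hgZ' i]
    simp_rw [hCdot, hentry]

end General

end Polchinski

end Literature.Analysis.FunctionSpaces

end
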